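import Summits.BirchSwinnertonDyer.BirchSwinnertonDyer.Theses.ShadowIsolation
import Summits.BirchSwinnertonDyer.BirchSwinnertonDyer.Theorems.ShadowIsolationShaUnboundedOfCorank
import Literature.NumberTheory.EllipticCurves.IwasawaLeadingTermProofs
import HarnessLib

/-!
# BirchSwinnertonDyer / ShadowIsolation — crux `ShaCotorsionReducible` (stmt-BirchSwinnertonDyer-15277),
# line `eisenstein-shadow`: NORMAL FORMS of its two stubs and the crux ⇒ S_red certificate (lead c4)

The line `eisenstein-shadow` (`Cruxes/ShaCotorsionReducible/Lines/eisenstein_shadow.lean`) attacks the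
crux `R = ShaCotorsionReducible` — for `W/ℚ` globally minimal elliptic and `p ≥ 5` good ordinary with
`E[p]` REDUCIBLE, `corank_{ℤ_p} Ш(W)[p^∞] = 0` — through two statements about ACCIDENTAL ZEROS AT DEPTH
`n`: data `(M, g, R, φ)` with `M` squarefree coprime to `p·N_W`, `g ∈ S₂(Γ₀(N_W·M))` a newform whose
`q`-expansion is not `(aₘ(W))ₘ`, Fricke `w g = -g`, `φ : R → ℤ/pⁿ` a ring map on a subring `R ⊆ ℂ`
containing the `a_ℓ(g)` (`ℓ ∤ N_W·M`) with `φ(a_ℓ(g)) = a_ℓ(W)`, and an entire continuation of `L(g,s)`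
vanishing at `s = 1` (write `AZ(W,p,n)` for their existence; the predicate is INLINED below, no
definition is introduced):

* S_red (`stub_shadowBeyondEisensteinDepth`): on the sector, `∃ e, ∀ n ≥ 1`, a class of `Ш(W)` of
  exact order `p^(n+e)` forces `AZ(W,p,n)`;
* I_red (`Sig.isolationReducible`, derived in the skeleton from modularity and the finiteness stub
  F_red): on the sector, `∃ n₀, ∀ n ≥ n₀, ¬ AZ(W,p,n)`.

This file records, sorry-free and on the standard axioms, what the two statements ARE logically, so
that the planners read the exact open residue of the line off the ledger:

* `eisShadow_not_exists_addOrderOf_eq_of_shaCorank_eq_zero` — if `corank Ш(W)[p^∞] = 0` then there is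
  `e` with NO class of exact order `p^(n+e)`, `n ≥ 1` (the tree theorem
  `finite_primaryComponent_sha_iff_shaCorank_eq_zero`, i.e. `Ш[p]` finite + corank `0` ⇒ `Ш[p^∞]`
  finite, and Lagrange);
* `shadowBeyondEisensteinDepth_of_shaCotorsionReducible` — **the crux IMPLIES S_red** (certificate that
  the load-bearing stub is crux-implied: its hypothesis is vacuous once `Ш[p^∞]` is finite);
* `eisShadow_shadow_iff_pointwise` — POINTWISE NORMAL FORM of S_red at `(W,p)`:
  `(∃ e, ∀ n ≥ 1, (∃ σ, |σ| = p^(n+e)) → AZ n) ↔ (shaCorank W p = 0 ∨ ∀ n ≥ 1, AZ n)` (the proved support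
  item `ShaUnboundedOfCorank` supplies classes of every order when the corank is positive);
* `eisShadow_isolation_iff_pointwise` — POINTWISE NORMAL FORM of I_red at `(W,p)`:
  `(∃ n₀, ∀ n ≥ n₀, ¬ AZ n) ↔ ∃ n, 1 ≤ n ∧ ¬ AZ n` (depth is antitone: reduce `φ` modulo `p^m`);
* `eisShadow_shaCorank_eq_zero_iff_shadow_of_isolation` — hence, at every `(W,p)` where I_red holds,
  S_red(W,p) is EQUIVALENT to `shaCorank W p = 0`: modulo isolation the load-bearing stub is exactly the
  crux, and its only non-vacuous content is "a divisible `Ш[p^∞]` casts an accidental zero at EVERY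
  depth `n ≥ 1`";
* `shaCotorsionReducible_iff_shadow_of_isolation` — the same for the route decl BY NAME: I_red on the
  sector ⇒ (S_red ⇔ `ShaCotorsionReducible`).

Nothing here is conditional; no named fact is assumed. The sector hypotheses (`5 ≤ p`, good ordinary,
reducible) are never used by the algebra — they only place `(W,p)` in the sector of the stubs.
-/

set_option linter.dupNamespace false

namespace Summit.BirchSwinnertonDyer.BirchSwinnertonDyer.Theorems

open scoped MatrixGroups ModularForm
open CongruenceSubgroup UpperHalfPlane
open Literature.NumberTheory.EllipticCurves Literature.NumberTheory.EllipticCurves.ModularForms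
open Summit.BirchSwinnertonDyer.BirchSwinnertonDyer.Theses

/-! ## §1 Algebra of `Ш`: cotorsion ⇒ no classes of large `p`-power order -/

/-- If `corank_{ℤ_p} Ш(W)[p^∞] = 0` then there is `e : ℕ` (the order of the finite group `Ш(W)[p^∞]`
will do) such that NO class of `Ш(W)` has exact order `p^(n+e)` with `n ≥ 1`: by the tree theorem
`finite_primaryComponent_sha_iff_shaCorank_eq_zero` (`Ш[p]` finite by weak Mordell–Weil, and corank
`0`) the `p`-primary part is finite, a class of `p`-power order lies in it, and its order divides
`#Ш[p^∞] = e < p^(n+e)`. [folklore] -/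
theorem eisShadow_not_exists_addOrderOf_eq_of_shaCorank_eq_zero (W : WeierstrassCurve ℚ) [W.IsElliptic]
    (p : ℕ) [Fact p.Prime] (h0 : W.shaCorank p = 0) :
    ∃ e : ℕ, ∀ n : ℕ, 1 ≤ n → ¬ ∃ σ : W.sha, addOrderOf σ = p ^ (n + e) := by
  haveI hfin : Finite (AddCommGroup.primaryComponent W.sha p) :=
    (finite_primaryComponent_sha_iff_shaCorank_eq_zero W p).mpr h0
  refine ⟨Nat.card (AddCommGroup.primaryComponent W.sha p), fun n _ ↦ ?_⟩
  rintro ⟨σ, hσ⟩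
  have hmem : σ ∈ AddCommGroup.primaryComponent W.sha p :=
    (AddCommGroup.mem_primaryComponent_iff_addOrderOf).mpr ⟨_, hσ⟩
  have hdvd : addOrderOf σ ∣ Nat.card (AddCommGroup.primaryComponent W.sha p) :=
    AddSubgroup.addOrderOf_dvd_natCard _ hmem
  have hle : p ^ (n + Nat.card (AddCommGroup.primaryComponent W.sha p)) ≤
      Nat.card (AddCommGroup.primaryComponent W.sha p) :=
    hσ ▸ Nat.le_of_dvd Nat.card_pos hdvd
  have hlt : n + Nat.card (AddCommGroup.primaryComponent W.sha p) <
      p ^ (n + Nat.card (AddCommGroup.primaryComponent W.sha p)) :=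
    Nat.lt_pow_self (Fact.out : p.Prime).one_lt
  omega

/-! ## §2 The crux implies S_red -/

/-- **Certificate: the crux implies the load-bearing stub S_red of line `eisenstein-shadow`.** If
`ShaCotorsionReducible` holds then on the Eisenstein sector `corank Ш(W)[p^∞] = 0`, so by
`eisShadow_not_exists_addOrderOf_eq_of_shaCorank_eq_zero` there is `e` beyond which the hypothesis
"`Ш(W)` has a class of exact order `p^(n+e)`, `n ≥ 1`" of S_red is never met; S_red holds vacuously
with that `e`. So S_red is crux-IMPLIED: its non-vacuous content concerns a hypothetical divisible
`Ш[p^∞]` only. [folklore] -/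
theorem shadowBeyondEisensteinDepth_of_shaCotorsionReducible :
    ShadowIsolation.ShaCotorsionReducible →
    ∀ (W : WeierstrassCurve ℚ) [W.IsElliptic] [W.IsGloballyMinimal] (p : ℕ) [Fact p.Prime], 5 ≤ p → W.HasGoodReductionAtPrime p → ¬ (p : ℤ) ∣ W.frobeniusTrace p → ¬ W.HasIrreducibleModPGaloisRep p → ∃ e : ℕ, ∀ n : ℕ, 1 ≤ n → (∃ σ : W.sha, addOrderOf σ = p ^ (n + e)) → ∃ (M : ℕ) (_ : NeZero (W.conductorNorm ℤ * M)) (g : CuspForm (CongruenceSubgroup.Gamma0 (W.conductorNorm ℤ * M)) 2) (R : Subring ℂ) (φ : R →+* ZMod (p ^ (n))) (hR : ∀ ℓ : ℕ, ℓ.Prime → ¬ ℓ ∣ W.conductorNorm ℤ * M → Literature.NumberTheory.EllipticCurves.ModularForms.heckeEigenvalue g ℓ ∈ R), Squarefree M ∧ Nat.Coprime M (p * W.conductorNorm ℤ) ∧ Literature.NumberTheory.EllipticCurves.ModularForms.IsNewform0 g ∧ (∃ m : ℕ, (UpperHalfPlane.qExpansion 1 ⇑g).coeff m ≠ ((W.LFunction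 m : ℤ) : ℂ)) ∧ Literature.NumberTheory.EllipticCurves.ModularForms.cuspHeckeOperatorₗ (CongruenceSubgroup.Gamma0 (W.conductorNorm ℤ * M)) 2 (Literature.NumberTheory.EllipticCurves.ModularForms.slToGLPos ModularGroup.S * Literature.NumberTheory.EllipticCurves.ModularForms.diagGL ((W.conductorNorm ℤ * M : ℕ) : ℚ) 1 (Nat.cast_pos.mpr (NeZero.pos (W.conductorNorm ℤ * M))) one_pos) g = -g ∧ (∀ (ℓ : ℕ) (hℓ : ℓ.Prime) (hℓL : ¬ ℓ ∣ W.conductorNorm ℤ * M), φ ⟨Literature.NumberTheory.EllipticCurves.ModularForms.heckeEigenvalue g ℓ, hR ℓ hℓ hℓL⟩ = ((W.frobeniusTrace ℓ : ℤ) : ZMod (p ^ (n)))) ∧ ∃ Λ : ℂ → ℂ, Differentiable ℂ Λ ∧ (∀ s : ℂ, 2 < s.re → Λ s = LSeries (fun m ↦ (UpperHalfPlane.qExpansion 1 ⇑g).coeff m) s) ∧ Λ 1 = 0 := by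
  intro hR W _ _ p _ h5 hgood hord hred
  obtain ⟨e, he⟩ :=
    eisShadow_not_exists_addOrderOf_eq_of_shaCorank_eq_zero W p (hR W p h5 hgood hord hred)
  exact ⟨e, fun n hn hσ ↦ (he n hn hσ).elim⟩

/-! ## §3 Pointwise normal forms of the two stubs -/

/-- **Pointwise normal form of S_red.** For `W/ℚ` elliptic and `p` prime, the S_red clause at `(W,p)` —
`∃ e, ∀ n ≥ 1, (∃ σ ∈ Ш(W), |σ| = p^(n+e)) → AZ(W,p,n)` — is EQUIVALENT to the dichotomy
`corank Ш(W)[p^∞] = 0 ∨ ∀ n ≥ 1, AZ(W,p,n)`. (⇐) corank `0`: take the `e` of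
`eisShadow_not_exists_addOrderOf_eq_of_shaCorank_eq_zero` (vacuous); accidental zeros at every depth:
`e = 0`. (⇒) if the corank is not `0`, the PROVED support item `ShaUnboundedOfCorank`
(`shaUnboundedOfCorank_proof`) gives a class of every exact order `p^(n+e)`, so `AZ(W,p,n)` for all
`n ≥ 1`. [folklore] -/
theorem eisShadow_shadow_iff_pointwise (W : WeierstrassCurve ℚ) [W.IsElliptic] [W.IsGloballyMinimal]
    (p : ℕ) [Fact p.Prime] :
    (∃ e : ℕ, ∀ n : ℕ, 1 ≤ n → (∃ σ : W.sha, addOrderOf σ = p ^ (n + e)) → ∃ (M : ℕ) (_ : NeZero (W.conductorNorm ℤ * M)) (g : CuspForm (CongruenceSubgroup.Gamma0 (W.conductorNorm ℤ * M)) 2) (R : Subring ℂ) (φ : R →+* ZMod (p ^ (n))) (hR : ∀ ℓ : ℕ, ℓ.Prime → ¬ ℓ ∣ W.conductorNorm ℤ * M → Literature.NumberTheory.EllipticCurves.ModularForms.heckeEigenvalue g ℓ ∈ R), Squarefree M ∧ Nat.Coprime M (p * W.conductorNorm ℤ) ∧ Literature.NumberTheory.EllipticCurves.ModularForms.IsNewform0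 g ∧ (∃ m : ℕ, (UpperHalfPlane.qExpansion 1 ⇑g).coeff m ≠ ((W.LFunction m : ℤ) : ℂ)) ∧ Literature.NumberTheory.EllipticCurves.ModularForms.cuspHeckeOperatorₗ (CongruenceSubgroup.Gamma0 (W.conductorNorm ℤ * M)) 2 (Literature.NumberTheory.EllipticCurves.ModularForms.slToGLPos ModularGroup.S * Literature.NumberTheory.EllipticCurves.ModularForms.diagGL ((W.conductorNorm ℤ * M : ℕ) : ℚ) 1 (Nat.cast_pos.mpr (NeZero.pos (W.conductorNorm ℤ * M))) one_pos) g = -g ∧ (∀ (ℓ : ℕ) (hℓ : ℓ.Prime) (hℓL : ¬ ℓ ∣ W.conductorNorm ℤ * M), φ ⟨Literature.NumberTheory.EllipticCurves.ModularForms.heckeEigenvalue g ℓ, hR ℓ hℓ hℓL⟩ = ((W.frobeniusTrace ℓ : ℤ) : ZMod (p ^ (n)))) ∧ ∃ Λ : ℂ → ℂ, Differentiable ℂ Λ ∧ (∀ s : ℂ, 2 < s.re → Λ s = LSeries (fun m ↦ (UpperHalfPlane.qExpansion 1 ⇑g).coeff m) s) ∧ Λ 1 = 0) ↔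
    (W.shaCorank p = 0 ∨ ∀ n : ℕ, 1 ≤ n → ∃ (M : ℕ) (_ : NeZero (W.conductorNorm ℤ * M)) (g : CuspForm (CongruenceSubgroup.Gamma0 (W.conductorNorm ℤ * M)) 2) (R : Subring ℂ) (φ : R →+* ZMod (p ^ (n))) (hR : ∀ ℓ : ℕ, ℓ.Prime → ¬ ℓ ∣ W.conductorNorm ℤ * M → Literature.NumberTheory.EllipticCurves.ModularForms.heckeEigenvalue g ℓ ∈ R), Squarefree M ∧ Nat.Coprime M (p * W.conductorNorm ℤ) ∧ Literature.NumberTheory.EllipticCurves.ModularForms.IsNewform0 g ∧ (∃ m : ℕ, (UpperHalfPlane.qExpansion 1 ⇑g).coeff m ≠ ((W.LFunction m : ℤ) : ℂ)) ∧ Literature.NumberTheory.EllipticCurves.ModularForms.cuspHeckeOperatorₗ (CongruenceSubgroup.Gamma0 (W.conductorNorm ℤ * M)) 2 (Literature.NumberTheory.EllipticCurves.ModularForms.slToGLPos ModularGroup.S * Literature.NumberTheory.EllipticCurves.ModularForms.diagGL ((W.conductorNorm ℤ * M : ℕ) : ℚ) 1 (Nat.cast_pos.mpr (NeZero.pos (W.conductorNorm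 ℤ * M))) one_pos) g = -g ∧ (∀ (ℓ : ℕ) (hℓ : ℓ.Prime) (hℓL : ¬ ℓ ∣ W.conductorNorm ℤ * M), φ ⟨Literature.NumberTheory.EllipticCurves.ModularForms.heckeEigenvalue g ℓ, hR ℓ hℓ hℓL⟩ = ((W.frobeniusTrace ℓ : ℤ) : ZMod (p ^ (n)))) ∧ ∃ Λ : ℂ → ℂ, Differentiable ℂ Λ ∧ (∀ s : ℂ, 2 < s.re → Λ s = LSeries (fun m ↦ (UpperHalfPlane.qExpansion 1 ⇑g).coeff m) s) ∧ Λ 1 = 0) := by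
  constructor
  · rintro ⟨e, he⟩
    by_cases h0 : W.shaCorank p = 0
    · exact Or.inl h0
    · refine Or.inr fun n hn ↦ he n hn ?_
      exact shaUnboundedOfCorank_proof W p h0 (n + e)
  · rintro (h0 | hall)
    · obtain ⟨e, he⟩ := eisShadow_not_exists_addOrderOf_eq_of_shaCorank_eq_zero W p h0
      exact ⟨e, fun n hn hσ ↦ (he n hn hσ).elim⟩
    · exact ⟨0, fun n hn _ ↦ hall n hn⟩

/-- **Depth is antitone.** An accidental zero at depth `n` is one at every depth `m ≤ n`: compose the
congruence map `φ : R → ℤ/pⁿ` with the reduction `ℤ/pⁿ → ℤ/p^m` (`ZMod.castHom`). [folklore] -/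
theorem eisShadow_accidentalZero_anti (W : WeierstrassCurve ℚ) [W.IsElliptic] [W.IsGloballyMinimal]
    (p : ℕ) [Fact p.Prime] {m n : ℕ} (hmn : m ≤ n) :
    (∃ (M : ℕ) (_ : NeZero (W.conductorNorm ℤ * M)) (g : CuspForm (CongruenceSubgroup.Gamma0 (W.conductorNorm ℤ * M)) 2) (R : Subring ℂ) (φ : R →+* ZMod (p ^ (n))) (hR : ∀ ℓ : ℕ, ℓ.Prime → ¬ ℓ ∣ W.conductorNorm ℤ * M → Literature.NumberTheory.EllipticCurves.ModularForms.heckeEigenvalue g ℓ ∈ R), Squarefree M ∧ Nat.Coprime M (p * W.conductorNorm ℤ) ∧ Literature.NumberTheory.EllipticCurves.ModularForms.IsNewform0 g ∧ (∃ m : ℕ, (UpperHalfPlane.qExpansion 1 ⇑g).coeff m ≠ ((W.LFunction m : ℤ) : ℂ)) ∧ Literature.NumberTheory.EllipticCurves.ModularForms.cuspHeckeOperatorₗ (CongruenceSubgroup.Gamma0 (W.conductorNorm ℤ * M)) 2 (Literature.NumberTheory.EllipticCurves.ModularForms.slToGLPos ModularGroup.S * Literature.NumberTheory.EllipticCurves.ModularForms.diagGL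 ((W.conductorNorm ℤ * M : ℕ) : ℚ) 1 (Nat.cast_pos.mpr (NeZero.pos (W.conductorNorm ℤ * M))) one_pos) g = -g ∧ (∀ (ℓ : ℕ) (hℓ : ℓ.Prime) (hℓL : ¬ ℓ ∣ W.conductorNorm ℤ * M), φ ⟨Literature.NumberTheory.EllipticCurves.ModularForms.heckeEigenvalue g ℓ, hR ℓ hℓ hℓL⟩ = ((W.frobeniusTrace ℓ : ℤ) : ZMod (p ^ (n)))) ∧ ∃ Λ : ℂ → ℂ, Differentiable ℂ Λ ∧ (∀ s : ℂ, 2 < s.re → Λ s = LSeries (fun m ↦ (UpperHalfPlane.qExpansion 1 ⇑g).coeff m) s) ∧ Λ 1 = 0) → ∃ (M : ℕ) (_ : NeZero (W.conductorNorm ℤ * M)) (g : CuspForm (CongruenceSubgroup.Gamma0 (W.conductorNorm ℤ * M)) 2) (R : Subring ℂ) (φ : R →+* ZMod (p ^ (m))) (hR : ∀ ℓ : ℕ, ℓ.Prime → ¬ ℓ ∣ W.conductorNorm ℤ * M → Literature.NumberTheory.EllipticCurves.ModularForms.heckeEigenvalue g ℓ ∈ R), Squarefree M ∧ Nat.Coprime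 M (p * W.conductorNorm ℤ) ∧ Literature.NumberTheory.EllipticCurves.ModularForms.IsNewform0 g ∧ (∃ m : ℕ, (UpperHalfPlane.qExpansion 1 ⇑g).coeff m ≠ ((W.LFunction m : ℤ) : ℂ)) ∧ Literature.NumberTheory.EllipticCurves.ModularForms.cuspHeckeOperatorₗ (CongruenceSubgroup.Gamma0 (W.conductorNorm ℤ * M)) 2 (Literature.NumberTheory.EllipticCurves.ModularForms.slToGLPos ModularGroup.S * Literature.NumberTheory.EllipticCurves.ModularForms.diagGL ((W.conductorNorm ℤ * M : ℕ) : ℚ) 1 (Nat.cast_pos.mpr (NeZero.pos (W.conductorNorm ℤ * M))) one_pos) g = -g ∧ (∀ (ℓ : ℕ) (hℓ : ℓ.Prime) (hℓL : ¬ ℓ ∣ W.conductorNorm ℤ * M), φ ⟨Literature.NumberTheory.EllipticCurves.ModularForms.heckeEigenvalue g ℓ, hR ℓ hℓ hℓL⟩ = ((W.frobeniusTrace ℓ : ℤ) : ZMod (p ^ (m)))) ∧ ∃ Λ : ℂ → ℂ, Differentiable ℂ Λ ∧ (∀ s : ℂ, 2 < s.re → Λ s = LSeries (fun m ↦ (UpperHalfPlane.qExpansion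 1 ⇑g).coeff m) s) ∧ Λ 1 = 0 := by
  rintro ⟨M, hM, g, R, φ, hR, hsq, hcop, hnew, hmis, hfr, hcong, hΛ⟩
  refine ⟨M, hM, g, R, (ZMod.castHom (pow_dvd_pow p hmn) (ZMod (p ^ m))).comp φ, hR, hsq, hcop, hnew,
    hmis, hfr, ?_, hΛ⟩
  intro ℓ hℓ hℓL
  rw [RingHom.comp_apply, hcong ℓ hℓ hℓL, map_intCast]

/-- **Pointwise normal form of I_red.** For `W/ℚ` globally minimal elliptic and `p` prime, the isolation
clause at `(W,p)` — `∃ n₀, ∀ n ≥ n₀, ¬ AZ(W,p,n)` — is EQUIVALENT to `∃ n ≥ 1, ¬ AZ(W,p,n)`: depth is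
antitone (`eisShadow_accidentalZero_anti`), so the accidental-zero depths form an initial segment and
isolation beyond some depth is the failure of `AZ` at ONE positive depth. [folklore] -/
theorem eisShadow_isolation_iff_pointwise (W : WeierstrassCurve ℚ) [W.IsElliptic] [W.IsGloballyMinimal]
    (p : ℕ) [Fact p.Prime] :
    (∃ n₀ : ℕ, ∀ n : ℕ, n₀ ≤ n → ¬ ∃ (M : ℕ) (_ : NeZero (W.conductorNorm ℤ * M)) (g : CuspForm (CongruenceSubgroup.Gamma0 (W.conductorNorm ℤ * M)) 2) (R : Subring ℂ) (φ : R →+* ZMod (p ^ (n))) (hR : ∀ ℓ : ℕ, ℓ.Prime → ¬ ℓ ∣ W.conductorNorm ℤ * M → Literature.NumberTheory.EllipticCurves.ModularForms.heckeEigenvalue g ℓ ∈ R), Squarefree M ∧ Nat.Coprime M (p * W.conductorNorm ℤ) ∧ Literature.NumberTheory.EllipticCurves.ModularForms.IsNewform0 g ∧ (∃ m : ℕ, (UpperHalfPlane.qExpansion 1 ⇑g).coeff m ≠ ((W.LFunction m : ℤ) : ℂ)) ∧ Literature.NumberTheory.EllipticCurves.ModularForms.cuspHeckeOperatorₗ (CongruenceSubgroup.Gamma0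 (W.conductorNorm ℤ * M)) 2 (Literature.NumberTheory.EllipticCurves.ModularForms.slToGLPos ModularGroup.S * Literature.NumberTheory.EllipticCurves.ModularForms.diagGL ((W.conductorNorm ℤ * M : ℕ) : ℚ) 1 (Nat.cast_pos.mpr (NeZero.pos (W.conductorNorm ℤ * M))) one_pos) g = -g ∧ (∀ (ℓ : ℕ) (hℓ : ℓ.Prime) (hℓL : ¬ ℓ ∣ W.conductorNorm ℤ * M), φ ⟨Literature.NumberTheory.EllipticCurves.ModularForms.heckeEigenvalue g ℓ, hR ℓ hℓ hℓL⟩ = ((W.frobeniusTrace ℓ : ℤ) : ZMod (p ^ (n)))) ∧ ∃ Λ : ℂ → ℂ, Differentiable ℂ Λ ∧ (∀ s : ℂ, 2 < s.re → Λ s = LSeries (fun m ↦ (UpperHalfPlane.qExpansion 1 ⇑g).coeff m) s) ∧ Λ 1 = 0) ↔ (∃ n : ℕ, 1 ≤ n ∧ ¬ ∃ (M : ℕ) (_ : NeZero (W.conductorNorm ℤ * M)) (g : CuspForm (CongruenceSubgroup.Gamma0 (W.conductorNorm ℤ * M)) 2) (R : Subring ℂ) (φ : R →+* ZMod (p ^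 (n))) (hR : ∀ ℓ : ℕ, ℓ.Prime → ¬ ℓ ∣ W.conductorNorm ℤ * M → Literature.NumberTheory.EllipticCurves.ModularForms.heckeEigenvalue g ℓ ∈ R), Squarefree M ∧ Nat.Coprime M (p * W.conductorNorm ℤ) ∧ Literature.NumberTheory.EllipticCurves.ModularForms.IsNewform0 g ∧ (∃ m : ℕ, (UpperHalfPlane.qExpansion 1 ⇑g).coeff m ≠ ((W.LFunction m : ℤ) : ℂ)) ∧ Literature.NumberTheory.EllipticCurves.ModularForms.cuspHeckeOperatorₗ (CongruenceSubgroup.Gamma0 (W.conductorNorm ℤ * M)) 2 (Literature.NumberTheory.EllipticCurves.ModularForms.slToGLPos ModularGroup.S * Literature.NumberTheory.EllipticCurves.ModularForms.diagGL ((W.conductorNorm ℤ * M : ℕ) : ℚ) 1 (Nat.cast_pos.mpr (NeZero.pos (W.conductorNorm ℤ * M))) one_pos) g = -g ∧ (∀ (ℓ : ℕ) (hℓ : ℓ.Prime) (hℓL : ¬ ℓ ∣ W.conductorNorm ℤ * M), φ ⟨Literature.NumberTheory.EllipticCurves.ModularForms.heckeEigenvalue g ℓ, hR ℓ hℓ hℓL⟩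 = ((W.frobeniusTrace ℓ : ℤ) : ZMod (p ^ (n)))) ∧ ∃ Λ : ℂ → ℂ, Differentiable ℂ Λ ∧ (∀ s : ℂ, 2 < s.re → Λ s = LSeries (fun m ↦ (UpperHalfPlane.qExpansion 1 ⇑g).coeff m) s) ∧ Λ 1 = 0) := by
  constructor
  · rintro ⟨n₀, hn₀⟩
    exact ⟨max n₀ 1, le_max_right _ _, hn₀ _ (le_max_left _ _)⟩
  · rintro ⟨n₁, -, hn₁⟩
    exact ⟨n₁, fun n hn hAZ ↦ hn₁ (eisShadow_accidentalZero_anti W p hn hAZ)⟩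

/-! ## §4 Modulo isolation, S_red IS the crux -/

/-- **At a point `(W,p)` where isolation holds, S_red(W,p) ⇔ `corank Ш(W)[p^∞] = 0`.** (⇐) is the
vacuity of §2. (⇒): by the normal form of S_red either the corank is `0` or there are accidental zeros
at every depth `n ≥ 1`, and the latter contradicts isolation at the depth `max n₀ 1`. So the composition
of line `eisenstein-shadow` loses nothing and gains nothing at the level of logic: given I_red, proving
S_red is proving the crux, pointwise. [folklore] -/
theorem eisShadow_shaCorank_eq_zero_iff_shadow_of_isolation (W : WeierstrassCurve ℚ) [W.IsElliptic]
    [W.IsGloballyMinimal] (p : ℕ) [Fact p.Prime]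
    (hI : ∃ n₀ : ℕ, ∀ n : ℕ, n₀ ≤ n → ¬ ∃ (M : ℕ) (_ : NeZero (W.conductorNorm ℤ * M)) (g : CuspForm (CongruenceSubgroup.Gamma0 (W.conductorNorm ℤ * M)) 2) (R : Subring ℂ) (φ : R →+* ZMod (p ^ (n))) (hR : ∀ ℓ : ℕ, ℓ.Prime → ¬ ℓ ∣ W.conductorNorm ℤ * M → Literature.NumberTheory.EllipticCurves.ModularForms.heckeEigenvalue g ℓ ∈ R), Squarefree M ∧ Nat.Coprime M (p * W.conductorNorm ℤ) ∧ Literature.NumberTheory.EllipticCurves.ModularForms.IsNewform0 g ∧ (∃ m : ℕ, (UpperHalfPlane.qExpansion 1 ⇑g).coeff m ≠ ((W.LFunction m : ℤ) : ℂ)) ∧ Literature.NumberTheory.EllipticCurves.ModularForms.cuspHeckeOperatorₗ (CongruenceSubgroup.Gamma0 (W.conductorNorm ℤ * M)) 2 (Literature.NumberTheory.EllipticCurves.ModularForms.slToGLPos ModularGroup.S * Literature.NumberTheory.EllipticCurves.ModularForms.diagGL ((W.conductorNorm ℤ * M : ℕ) : ℚ) 1 (Nat.cast_pos.mpr (NeZero.pos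 (W.conductorNorm ℤ * M))) one_pos) g = -g ∧ (∀ (ℓ : ℕ) (hℓ : ℓ.Prime) (hℓL : ¬ ℓ ∣ W.conductorNorm ℤ * M), φ ⟨Literature.NumberTheory.EllipticCurves.ModularForms.heckeEigenvalue g ℓ, hR ℓ hℓ hℓL⟩ = ((W.frobeniusTrace ℓ : ℤ) : ZMod (p ^ (n)))) ∧ ∃ Λ : ℂ → ℂ, Differentiable ℂ Λ ∧ (∀ s : ℂ, 2 < s.re → Λ s = LSeries (fun m ↦ (UpperHalfPlane.qExpansion 1 ⇑g).coeff m) s) ∧ Λ 1 = 0) :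
    (∃ e : ℕ, ∀ n : ℕ, 1 ≤ n → (∃ σ : W.sha, addOrderOf σ = p ^ (n + e)) → ∃ (M : ℕ) (_ : NeZero (W.conductorNorm ℤ * M)) (g : CuspForm (CongruenceSubgroup.Gamma0 (W.conductorNorm ℤ * M)) 2) (R : Subring ℂ) (φ : R →+* ZMod (p ^ (n))) (hR : ∀ ℓ : ℕ, ℓ.Prime → ¬ ℓ ∣ W.conductorNorm ℤ * M → Literature.NumberTheory.EllipticCurves.ModularForms.heckeEigenvalue g ℓ ∈ R), Squarefree M ∧ Nat.Coprime M (p * W.conductorNorm ℤ) ∧ Literature.NumberTheory.EllipticCurves.ModularForms.IsNewform0 g ∧ (∃ m : ℕ, (UpperHalfPlane.qExpansion 1 ⇑g).coeff m ≠ ((W.LFunction m : ℤ) : ℂ)) ∧ Literature.NumberTheory.EllipticCurves.ModularForms.cuspHeckeOperatorₗ (CongruenceSubgroup.Gamma0 (W.conductorNorm ℤ * M)) 2 (Literature.NumberTheory.EllipticCurves.ModularForms.slToGLPos ModularGroup.S * Literature.NumberTheory.EllipticCurves.ModularForms.diagGL ((W.conductorNorm ℤ * M : ℕ) : ℚ)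 1 (Nat.cast_pos.mpr (NeZero.pos (W.conductorNorm ℤ * M))) one_pos) g = -g ∧ (∀ (ℓ : ℕ) (hℓ : ℓ.Prime) (hℓL : ¬ ℓ ∣ W.conductorNorm ℤ * M), φ ⟨Literature.NumberTheory.EllipticCurves.ModularForms.heckeEigenvalue g ℓ, hR ℓ hℓ hℓL⟩ = ((W.frobeniusTrace ℓ : ℤ) : ZMod (p ^ (n)))) ∧ ∃ Λ : ℂ → ℂ, Differentiable ℂ Λ ∧ (∀ s : ℂ, 2 < s.re → Λ s = LSeries (fun m ↦ (UpperHalfPlane.qExpansion 1 ⇑g).coeff m) s) ∧ Λ 1 = 0) ↔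
    W.shaCorank p = 0 := by
  rw [eisShadow_shadow_iff_pointwise W p]
  obtain ⟨n₀, hn₀⟩ := hI
  constructor
  · rintro (h0 | hall)
    · exact h0
    · exact (hn₀ (max n₀ 1) (le_max_left _ _) (hall (max n₀ 1) (le_max_right _ _))).elim
  · exact Or.inl

/-- **Modulo I_red, the load-bearing stub S_red of line `eisenstein-shadow` is EQUIVALENT to the crux
`ShaCotorsionReducible` (by name).** Given isolation on the Eisenstein sector (I_red, the statement the
skeleton derives from modularity and the finiteness stub F_red), S_red holds iff the crux holds: (⇐) by
`shadowBeyondEisensteinDepth_of_shaCotorsionReducible`, (⇒) pointwise by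
`eisShadow_shaCorank_eq_zero_iff_shadow_of_isolation`. [folklore] -/
theorem shaCotorsionReducible_iff_shadow_of_isolation : (∀ (W : WeierstrassCurve ℚ) [W.IsElliptic] [W.IsGloballyMinimal] (p : ℕ) [Fact p.Prime], 5 ≤ p → W.HasGoodReductionAtPrime p → ¬ (p : ℤ) ∣ W.frobeniusTrace p → ¬ W.HasIrreducibleModPGaloisRep p → ∃ n₀ : ℕ, ∀ n : ℕ, n₀ ≤ n → ¬ ∃ (M : ℕ) (_ : NeZero (W.conductorNorm ℤ * M)) (g : CuspForm (CongruenceSubgroup.Gamma0 (W.conductorNorm ℤ * M)) 2) (R : Subring ℂ) (φ : R →+* ZMod (p ^ (n))) (hR : ∀ ℓ : ℕ, ℓ.Prime → ¬ ℓ ∣ W.conductorNorm ℤ * M → Literature.NumberTheory.EllipticCurves.ModularForms.heckeEigenvalue g ℓ ∈ R), Squarefree M ∧ Nat.Coprime M (p * W.conductorNorm ℤ) ∧ Literature.NumberTheory.EllipticCurves.ModularForms.IsNewform0 g ∧ (∃ m : ℕ, (UpperHalfPlane.qExpansion 1 ⇑g).coeff m ≠ ((W.LFunction m : ℤ) : ℂ))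 ∧ Literature.NumberTheory.EllipticCurves.ModularForms.cuspHeckeOperatorₗ (CongruenceSubgroup.Gamma0 (W.conductorNorm ℤ * M)) 2 (Literature.NumberTheory.EllipticCurves.ModularForms.slToGLPos ModularGroup.S * Literature.NumberTheory.EllipticCurves.ModularForms.diagGL ((W.conductorNorm ℤ * M : ℕ) : ℚ) 1 (Nat.cast_pos.mpr (NeZero.pos (W.conductorNorm ℤ * M))) one_pos) g = -g ∧ (∀ (ℓ : ℕ) (hℓ : ℓ.Prime) (hℓL : ¬ ℓ ∣ W.conductorNorm ℤ * M), φ ⟨Literature.NumberTheory.EllipticCurves.ModularForms.heckeEigenvalue g ℓ, hR ℓ hℓ hℓL⟩ = ((W.frobeniusTrace ℓ : ℤ) : ZMod (p ^ (n)))) ∧ ∃ Λ : ℂ → ℂ, Differentiable ℂ Λ ∧ (∀ s : ℂ, 2 < s.re → Λ s = LSeries (fun m ↦ (UpperHalfPlane.qExpansion 1 ⇑g).coeff m) s) ∧ Λ 1 = 0) → ((∀ (W : WeierstrassCurve ℚ) [W.IsElliptic] [W.IsGloballyMinimal] (p : ℕ) [Fact p.Prime], 5 ≤ p → W.HasGoodReductionAtPrime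 p → ¬ (p : ℤ) ∣ W.frobeniusTrace p → ¬ W.HasIrreducibleModPGaloisRep p → ∃ e : ℕ, ∀ n : ℕ, 1 ≤ n → (∃ σ : W.sha, addOrderOf σ = p ^ (n + e)) → ∃ (M : ℕ) (_ : NeZero (W.conductorNorm ℤ * M)) (g : CuspForm (CongruenceSubgroup.Gamma0 (W.conductorNorm ℤ * M)) 2) (R : Subring ℂ) (φ : R →+* ZMod (p ^ (n))) (hR : ∀ ℓ : ℕ, ℓ.Prime → ¬ ℓ ∣ W.conductorNorm ℤ * M → Literature.NumberTheory.EllipticCurves.ModularForms.heckeEigenvalue g ℓ ∈ R), Squarefree M ∧ Nat.Coprime M (p * W.conductorNorm ℤ) ∧ Literature.NumberTheory.EllipticCurves.ModularForms.IsNewform0 g ∧ (∃ m : ℕ, (UpperHalfPlane.qExpansion 1 ⇑g).coeff m ≠ ((W.LFunction m : ℤ) : ℂ)) ∧ Literature.NumberTheory.EllipticCurves.ModularForms.cuspHeckeOperatorₗ (CongruenceSubgroup.Gamma0 (W.conductorNorm ℤ * M)) 2 (Literature.NumberTheory.EllipticCurves.ModularForms.slToGLPos ModularGroup.S * Literature.NumberTheory.EllipticCurves.ModularForms.diagGL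 ((W.conductorNorm ℤ * M : ℕ) : ℚ) 1 (Nat.cast_pos.mpr (NeZero.pos (W.conductorNorm ℤ * M))) one_pos) g = -g ∧ (∀ (ℓ : ℕ) (hℓ : ℓ.Prime) (hℓL : ¬ ℓ ∣ W.conductorNorm ℤ * M), φ ⟨Literature.NumberTheory.EllipticCurves.ModularForms.heckeEigenvalue g ℓ, hR ℓ hℓ hℓL⟩ = ((W.frobeniusTrace ℓ : ℤ) : ZMod (p ^ (n)))) ∧ ∃ Λ : ℂ → ℂ, Differentiable ℂ Λ ∧ (∀ s : ℂ, 2 < s.re → Λ s = LSeries (fun m ↦ (UpperHalfPlane.qExpansion 1 ⇑g).coeff m) s) ∧ Λ 1 = 0) ↔ Summit.BirchSwinnertonDyer.BirchSwinnertonDyer.Theses.ShadowIsolation.ShaCotorsionReducible) := by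
  intro hI
  constructor
  · intro hS W _ _ p _ h5 hgood hord hred
    exact (eisShadow_shaCorank_eq_zero_iff_shadow_of_isolation W p (hI W p h5 hgood hord hred)).mp
      (hS W p h5 hgood hord hred)
  · exact shadowBeyondEisensteinDepth_of_shaCotorsionReducible

/-- **The open residue of the line, by name.** Given isolation on the sector (I_red), the crux
`ShaCotorsionReducible` is EQUIVALENT to: at every `(W,p)` of the Eisenstein sector with
`corank Ш(W)[p^∞] ≠ 0` there are accidental zeros at EVERY depth `n ≥ 1` — i.e. to "a divisible
`Ш[p^∞]` at an Eisenstein prime casts an even-sign accidental zero at every depth" (deep sign-kept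
visibility), which is therefore the exact non-vacuous content of S_red. [folklore] -/
theorem shaCotorsionReducible_iff_divisible_casts_every_depth
    (hI : ∀ (W : WeierstrassCurve ℚ) [W.IsElliptic] [W.IsGloballyMinimal] (p : ℕ) [Fact p.Prime], 5 ≤ p → W.HasGoodReductionAtPrime p → ¬ (p : ℤ) ∣ W.frobeniusTrace p → ¬ W.HasIrreducibleModPGaloisRep p → ∃ n₀ : ℕ, ∀ n : ℕ, n₀ ≤ n → ¬ ∃ (M : ℕ) (_ : NeZero (W.conductorNorm ℤ * M)) (g : CuspForm (CongruenceSubgroup.Gamma0 (W.conductorNorm ℤ * M)) 2) (R : Subring ℂ) (φ : R →+* ZMod (p ^ (n))) (hR : ∀ ℓ : ℕ, ℓ.Prime → ¬ ℓ ∣ W.conductorNorm ℤ * M → Literature.NumberTheory.EllipticCurves.ModularForms.heckeEigenvalue g ℓ ∈ R), Squarefree M ∧ Nat.Coprime M (p * W.conductorNorm ℤ) ∧ Literature.NumberTheory.EllipticCurves.ModularForms.IsNewform0 g ∧ (∃ m : ℕ, (UpperHalfPlane.qExpansion 1 ⇑g).coeff m ≠ ((W.LFunction m : ℤ) : ℂ))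 ∧ Literature.NumberTheory.EllipticCurves.ModularForms.cuspHeckeOperatorₗ (CongruenceSubgroup.Gamma0 (W.conductorNorm ℤ * M)) 2 (Literature.NumberTheory.EllipticCurves.ModularForms.slToGLPos ModularGroup.S * Literature.NumberTheory.EllipticCurves.ModularForms.diagGL ((W.conductorNorm ℤ * M : ℕ) : ℚ) 1 (Nat.cast_pos.mpr (NeZero.pos (W.conductorNorm ℤ * M))) one_pos) g = -g ∧ (∀ (ℓ : ℕ) (hℓ : ℓ.Prime) (hℓL : ¬ ℓ ∣ W.conductorNorm ℤ * M), φ ⟨Literature.NumberTheory.EllipticCurves.ModularForms.heckeEigenvalue g ℓ, hR ℓ hℓ hℓL⟩ = ((W.frobeniusTrace ℓ : ℤ) : ZMod (p ^ (n)))) ∧ ∃ Λ : ℂ → ℂ, Differentiable ℂ Λ ∧ (∀ s : ℂ, 2 < s.re → Λ s = LSeries (fun m ↦ (UpperHalfPlane.qExpansion 1 ⇑g).coeff m) s) ∧ Λ 1 = 0) :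
    ShadowIsolation.ShaCotorsionReducible ↔
    (∀ (W : WeierstrassCurve ℚ) [W.IsElliptic] [W.IsGloballyMinimal] (p : ℕ) [Fact p.Prime], 5 ≤ p → W.HasGoodReductionAtPrime p → ¬ (p : ℤ) ∣ W.frobeniusTrace p → ¬ W.HasIrreducibleModPGaloisRep p → W.shaCorank p ≠ 0 → ∀ n : ℕ, 1 ≤ n → ∃ (M : ℕ) (_ : NeZero (W.conductorNorm ℤ * M)) (g : CuspForm (CongruenceSubgroup.Gamma0 (W.conductorNorm ℤ * M)) 2) (R : Subring ℂ) (φ : R →+* ZMod (p ^ (n))) (hR : ∀ ℓ : ℕ, ℓ.Prime → ¬ ℓ ∣ W.conductorNorm ℤ * M → Literature.NumberTheory.EllipticCurves.ModularForms.heckeEigenvalue g ℓ ∈ R), Squarefree M ∧ Nat.Coprime M (p * W.conductorNorm ℤ) ∧ Literature.NumberTheory.EllipticCurves.ModularForms.IsNewform0 g ∧ (∃ m : ℕ, (UpperHalfPlane.qExpansion 1 ⇑g).coeff m ≠ ((W.LFunction m : ℤ) : ℂ)) ∧ Literature.NumberTheory.EllipticCurves.ModularForms.cuspHeckeOperatorₗ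 (CongruenceSubgroup.Gamma0 (W.conductorNorm ℤ * M)) 2 (Literature.NumberTheory.EllipticCurves.ModularForms.slToGLPos ModularGroup.S * Literature.NumberTheory.EllipticCurves.ModularForms.diagGL ((W.conductorNorm ℤ * M : ℕ) : ℚ) 1 (Nat.cast_pos.mpr (NeZero.pos (W.conductorNorm ℤ * M))) one_pos) g = -g ∧ (∀ (ℓ : ℕ) (hℓ : ℓ.Prime) (hℓL : ¬ ℓ ∣ W.conductorNorm ℤ * M), φ ⟨Literature.NumberTheory.EllipticCurves.ModularForms.heckeEigenvalue g ℓ, hR ℓ hℓ hℓL⟩ = ((W.frobeniusTrace ℓ : ℤ) : ZMod (p ^ (n)))) ∧ ∃ Λ : ℂ → ℂ, Differentiable ℂ Λ ∧ (∀ s : ℂ, 2 < s.re → Λ s = LSeries (fun m ↦ (UpperHalfPlane.qExpansion 1 ⇑g).coeff m) s) ∧ Λ 1 = 0) := by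
  constructor
  · intro hR W _ _ p _ h5 hgood hord hred hne
    exact (hne (hR W p h5 hgood hord hred)).elim
  · intro hV W _ _ p _ h5 hgood hord hred
    by_contra hne
    obtain ⟨n₀, hn₀⟩ := hI W p h5 hgood hord hred
    exact hn₀ (max n₀ 1) (le_max_left _ _) (hV W p h5 hgood hord hred hne (max n₀ 1) (le_max_right _ _))

end Summit.BirchSwinnertonDyer.BirchSwinnertonDyer.Theorems
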